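import Mathlib.Algebra.Order.Archimedean.Real.Basic
import Mathlib.Order.ConditionallyCompleteLattice.Indexed
import Literature.Computability.Complexity.NonElementaryReal
import HarnessLib

/-!
# Effective diagonalisation against a computable double sequence of rationals

The recursion-theoretic engine behind Yoshinaga's non-period [Yoshinaga 2008, arXiv:0805.0349,
§2.3, Prop. 17; §3.1, Thm. 18] is the effective Cantor diagonal: *from any computable double
sequence of rationals `G : ℕ → ℕ → ℚ` one computes a real number `x` which no row `G i` names*,
quantitatively `1/(8·4^i) ≤ |x - G i (8·4^i)|` for every `i`, so that in particular no row is a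
`1/(n+1)`-name (or a `2⁻ⁿ`-name) of `x`. Yoshinaga applies it to the rows
`ḡ_e` enumerating the elementary reals (Def. 15, Prop. 17); the tree's
`Literature/Computability/Complexity/NonElementaryReal.lean` applies it to the enumeration
`primrecEnum` of the primitive recursive functions. This file isolates the engine, for an
ARBITRARY computable `G`, because this is the form in which it bears on periods: by Thm. 18 (or by
any uniform computability theorem for the values of coded integral representations, cf. the
hypothesis `UniformlyComputable` of
`Literature/Barriers/KontsevichZagierPeriods/PeriodEqualityDecidability.lean`) the real periods
are named by the rows of ONE computable double sequence, and then the diagonal real is a computable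
non-period (`Literature/NumberTheory/Transcendental/PeriodConjecture.lean`,
`exists_isComputableReal_not_isRealPeriod`).

## Main statements

* `UniformDiagonal.real G` — the diagonal real of `G`; `UniformDiagonal.isComputableReal_real` —
  it is computable when `G` is (`Computable₂ G`); `UniformDiagonal.le_abs_real_sub` —
  `1/(8·4^i) ≤ |real G - G i (8·4^i)|` for every row `i` (no computability needed).
* `exists_isComputableReal_forall_le_abs_sub` — packaged: for computable `G` there is a computable
  `x` with `1/(8·4^i) ≤ |x - G i (8·4^i)|` for all `i`. [folklore]
* `exists_isComputableReal_forall_not_name` — hence no row of `G` is a `1/(n+1)`-name of `x`,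
  and `exists_isComputableReal_forall_not_fastName` — nor a `2⁻ⁿ`-name. [folklore]
* `exists_isComputableReal_not_primrecReal` — corollary: a computable real which is not a
  *primitive recursive real* (no primitive recursive `a b c` with
  `|x - (a n - b n)/(c n + 1)| ≤ 1/(n+1)` for all `n`; the class `ℝ_ℰ`, `ℰ` = primitive recursive
  functions, of [Yoshinaga 2008, §2.1, Def. 2, Example 3 (3)]), by taking for `G` the triples of
  rows of `primrecEnum` (`NonElementaryReal.lean`). This sharpens
  `exists_isComputableReal_not_isElementaryReal` there (elementary ⊆ primitive recursive,
  `ElementaryRec.primrec_holds`), which is not restated. [folklore]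

## The construction

Stage `i` owns the closed interval `I_i = [m_i/4^i, (m_i+1)/4^i]` (`num G i = m_i`, `lower`,
`upper`), `I_0 = [0, 1]`. It reads the single rational `ρ_i = G i N_i` at the query point
`N_i = 8·4^i` (`queryPt`) and compares it with the midpoint of `I_i` (`goLeft`, a decidable
comparison in `ℚ`): if `midpoint ≤ ρ_i` it continues with the first quarter of `I_i` (digit `0`),
otherwise with the last quarter (digit `3`; `digit`, `num_succ`). Either way the open ball of
radius `1/(8·4^i)` about `ρ_i` is disjoint from `I_{i+1}`, so every real `β` in that ball differs
from the intersection point `x = real G = ⨆ m_i/4^i` (`real_ne`), i.e. `|x - ρ_i| ≥ 1/(8·4^i)`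
(`le_abs_real_sub`).
Since `|x - m_i/4^i| ≤ 4^{-i} ≤ 2^{-i}` and `i ↦ m_i/4^i = m_i/2^(2i)` is a computable map `ℕ → ℚ`
for Mathlib's `Primcodable ℚ` (`Computable.nat_rec` over the computable step; dyadic rationals by
`rat_natDivTwoPow_primrec`, the comparison by `rat_le_primrecRel`, both from
`ComputableRealProofs.lean`), `x` is a computable real (`isComputableReal_real`).

## References

* [Yoshinaga2008] M. Yoshinaga, *Periods and elementary real numbers*, arXiv:0805.0349 (2008),
  §2.1 (Def. 2, Example 3), §2.3 (Def. 15, Prop. 17), §3.1 (Thm. 18).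
* K. Weihrauch, *Computable Analysis* (2000), Def. 4.1.13 (computable reals; the tree's
  `IsComputableReal`).

## Design notes

* No named facts; the `def`s (`queryPt`, `goLeft`, `step`, `num`, `digit`, `lower`, `upper`,
  `real`, all in the namespace `UniformDiagonal` and parametrised by `G`) are the data of the
  construction.
* Indexing by `ℕ` rather than by a `Primcodable` type of codes costs nothing: a family indexed by
  codes is re-indexed along `Encodable.encode`/`decode` by the user.
-/

noncomputable section

namespace Literature.Computability.Complexity

open Encodable Denumerable

namespace UniformDiagonal

variable (G : ℕ → ℕ → ℚ)

/-- The query point of stage `i`: `N_i = 8 · 4^i`, so that a `1/(N+1)`-approximation read at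
`N = N_i` has error `< 1/(8 · 4^i)`. [folklore] -/
def queryPt (i : ℕ) : ℕ := 8 * 4 ^ i

/-- The midpoint `(2m+1)/(2·4^i) = (2m+1)/2^(2i+1)` of the interval `[m/4^i, (m+1)/4^i]`, as a
(dyadic) rational. [folklore] -/
def midpoint (i m : ℕ) : ℚ := ((2 * m + 1 : ℕ) : ℚ) / 2 ^ (2 * i + 1)

/-- Stage test: is the midpoint of the current interval at most the candidate `G i N_i`?  If so
the construction keeps the first quarter, otherwise the last quarter. [folklore] -/
def goLeft (i m : ℕ) : Bool := decide (midpoint i m ≤ G i (queryPt i))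

/-- One step of the recursion for the numerators: `m ↦ 4m` (first quarter) or `4m + 3` (last
quarter). [folklore] -/
def step (p : ℕ × ℕ) : ℕ := 4 * p.2 + cond (goLeft G p.1 p.2) 0 3

/-- The numerators `m_i` of the nested intervals `I_i = [m_i/4^i, (m_i+1)/4^i]`. [folklore] -/
def num (i : ℕ) : ℕ := Nat.rec 0 (fun y IH => step G (y, IH)) i

/-- The base-`4` digit chosen at stage `i`: `0` or `3`. [folklore] -/
def digit (i : ℕ) : ℕ := cond (goLeft G i (num G i)) 0 3

/-- `m_0 = 0`, i.e. `I_0 = [0, 1]`. [folklore] -/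
@[simp] theorem num_zero : num G 0 = 0 := rfl

/-- `m_{i+1} = 4 m_i + d_i`. [folklore] -/
theorem num_succ (i : ℕ) : num G (i + 1) = 4 * num G i + digit G i := rfl

/-- Digits are at most `3`. [folklore] -/
theorem digit_le_three (i : ℕ) : digit G i ≤ 3 := by
  unfold digit
  cases goLeft G i (num G i) <;> simp

/-- If the stage test succeeds the digit is `0`. [folklore] -/
theorem digit_of_goLeft {i : ℕ} (h : goLeft G i (num G i) = true) : digit G i = 0 := by
  simp [digit, h]

/-- If the stage test fails the digit is `3`. [folklore] -/
theorem digit_of_not_goLeft {i : ℕ} (h : goLeft G i (num G i) = false) : digit G i = 3 := by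
  simp [digit, h]

/-! #### Computability -/

/-- `i ↦ 4 ^ i` is primitive recursive. [folklore] -/
theorem primrec_four_pow : Primrec fun i : ℕ => 4 ^ i :=
  (Primrec₂.unpaired'.1 Nat.Primrec.pow).comp (Primrec.const 4) Primrec.id

/-- The query point is primitive recursive in the stage. [folklore] -/
theorem primrec_queryPt : Primrec queryPt :=
  Primrec.nat_mul.comp (Primrec.const 8) primrec_four_pow

/-- The midpoint is a primitive recursive function `ℕ × ℕ → ℚ` (a dyadic rational,
`rat_natDivTwoPow_primrec`). [folklore] -/
theorem primrec_midpoint : Primrec₂ midpoint := by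
  unfold midpoint
  exact rat_natDivTwoPow_primrec.comp
    (Primrec.succ.comp (Primrec.nat_mul.comp (Primrec.const 2) Primrec.snd))
    (Primrec.succ.comp (Primrec.nat_mul.comp (Primrec.const 2) Primrec.fst))

variable {G}

/-- For computable `G` the stage test is computable (`rat_le_primrecRel`). [folklore] -/
theorem computable_goLeft (hG : Computable₂ G) : Computable₂ (goLeft G) := by
  have hle : Computable₂ fun a b : ℚ => decide (a ≤ b) := rat_le_primrecRel.decide.to_comp
  have h := hle.comp primrec_midpoint.to_comp
    (hG.comp Computable.fst (primrec_queryPt.to_comp.comp Computable.fst))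
  exact h.of_eq fun p => rfl

/-- For computable `G` the step is computable. [folklore] -/
theorem computable_step (hG : Computable₂ G) : Computable (step G) := by
  unfold step
  exact Primrec.nat_add.to_comp.comp
    (Primrec.nat_mul.to_comp.comp (Computable.const 4) Computable.snd)
    (Computable.cond (computable_goLeft hG) (Computable.const 0) (Computable.const 3))

/-- For computable `G` the numerators form a computable sequence (`Computable.nat_rec`).
[folklore] -/
theorem computable_num (hG : Computable₂ G) : Computable (num G) :=
  (Computable.nat_rec Computable.id (Computable.const 0)
    (((computable_step hG).comp Computable.snd).to₂ :
      Computable₂ fun (_ : ℕ) (p : ℕ × ℕ) => step G p)).of_eq fun i => by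
    simp only [id_eq, num]

variable (G)

/-! #### The nested intervals -/

/-- Left endpoints `m_i / 4^i`. [folklore] -/
def lower (i : ℕ) : ℝ := (num G i : ℝ) / 4 ^ i

/-- Right endpoints `(m_i + 1) / 4^i`. [folklore] -/
def upper (i : ℕ) : ℝ := ((num G i : ℝ) + 1) / 4 ^ i

/-- `I_i` has length `4^{-i}`. [folklore] -/
theorem upper_eq (i : ℕ) : upper G i = lower G i + 1 / 4 ^ i := by
  unfold upper lower
  ring

/-- The left endpoint moves by `d_i / 4^{i+1}`. [folklore] -/
theorem lower_succ (i : ℕ) : lower G (i + 1) = lower G i + (digit G i : ℝ) / 4 ^ (i + 1) := by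
  unfold lower
  rw [num_succ]
  push_cast
  rw [pow_succ]
  have h4 : (4 : ℝ) ^ i ≠ 0 := pow_ne_zero _ (by norm_num)
  field_simp

/-- Left endpoints increase. [folklore] -/
theorem lower_mono : Monotone (lower G) := by
  refine monotone_nat_of_le_succ fun i => ?_
  rw [lower_succ]
  exact le_add_of_nonneg_right (by positivity)

/-- Right endpoints decrease (`d_i ≤ 3`): the intervals are nested. [folklore] -/
theorem upper_anti : Antitone (upper G) := by
  refine antitone_nat_of_succ_le fun i => ?_
  rw [upper_eq, upper_eq, lower_succ]
  have hd : ((digit G i : ℝ)) ≤ 3 := by exact_mod_cast digit_le_three G i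
  have h4 : (0 : ℝ) < 4 ^ i := by positivity
  rw [pow_succ]
  have key : (digit G i : ℝ) / (4 ^ i * 4) + 1 / (4 ^ i * 4) ≤ 1 / 4 ^ i := by
    rw [← add_div, div_le_div_iff₀ (by positivity) h4]
    nlinarith
  linarith

/-- `I_i` is non-empty. [folklore] -/
theorem lower_le_upper (i : ℕ) : lower G i ≤ upper G i := by
  rw [upper_eq]
  exact le_add_of_nonneg_right (by positivity)

/-- Every left endpoint is below every right endpoint. [folklore] -/
theorem lower_le_upper' (i j : ℕ) : lower G i ≤ upper G j :=
  (lower_mono G (le_max_left i j)).trans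
    ((lower_le_upper G _).trans (upper_anti G (le_max_right i j)))

/-- The left endpoints are bounded above. [folklore] -/
theorem bddAbove_range_lower : BddAbove (Set.range (lower G)) :=
  ⟨upper G 0, by rintro _ ⟨i, rfl⟩; exact lower_le_upper' G i 0⟩

/-- **The diagonal real** of `G`: the common point of the nested intervals `I_i`. [folklore] -/
def real : ℝ := ⨆ i, lower G i

/-- `x` lies right of every left endpoint. [folklore] -/
theorem lower_le_real (i : ℕ) : lower G i ≤ real G :=
  le_ciSup (bddAbove_range_lower G) i

/-- `x` lies left of every right endpoint: `x ∈ I_i` for all `i`. [folklore] -/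
theorem real_le_upper (i : ℕ) : real G ≤ upper G i :=
  ciSup_le fun j => lower_le_upper' G j i

/-- `|x - m_i/4^i| ≤ 4^{-i}`. [folklore] -/
theorem abs_real_sub_lower_le (i : ℕ) : |real G - lower G i| ≤ 1 / 4 ^ i := by
  rw [abs_of_nonneg (sub_nonneg.2 (lower_le_real G i))]
  have := real_le_upper G i
  rw [upper_eq] at this
  linarith

variable {G}

/-- **The diagonal real is computable** when `G` is: `i ↦ m_i/4^i = m_i/2^(2i)` is a computable
fast Cauchy name. [folklore] -/
theorem isComputableReal_real (hG : Computable₂ G) : IsComputableReal (real G) := by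
  refine ⟨fun i => (num G i : ℚ) / 2 ^ (2 * i), ?_, fun i => ?_⟩
  · exact rat_natDivTwoPow_primrec.to_comp.comp (computable_num hG)
      (Primrec.nat_mul.comp (Primrec.const 2) Primrec.id).to_comp
  · have hcast : (((num G i : ℚ) / 2 ^ (2 * i) : ℚ) : ℝ) = lower G i := by
      unfold lower
      push_cast
      rw [pow_mul]
      norm_num
    rw [hcast]
    refine (abs_real_sub_lower_le G i).trans ?_
    rw [one_div_pow, one_div_le_one_div (by positivity) (by positivity)]
    exact pow_le_pow_left₀ (by norm_num) (by norm_num) i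

variable (G)

/-! #### The exclusion -/

/-- The stage test decides `midpoint ≤ ρ_i` over `ℝ`. [folklore] -/
theorem goLeft_eq_true_iff (i m : ℕ) :
    goLeft G i m = true ↔ (2 * (m : ℝ) + 1) / (2 * 4 ^ i) ≤ ((G i (queryPt i) : ℚ) : ℝ) := by
  rw [goLeft, decide_eq_true_iff, ← Rat.cast_le (K := ℝ), midpoint]
  push_cast
  rw [pow_succ, pow_mul]
  norm_num
  rw [mul_comm (2 : ℝ) (4 ^ i)]

/-- **Diagonal exclusion.** Every real within `1/(8 · 4^i)` of the stage-`i` candidate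
`ρ_i = G i N_i` differs from the diagonal real: if `midpoint(I_i) ≤ ρ_i` the construction continues
in the first quarter of `I_i`, else in the last quarter, leaving a gap of `1/(8 · 4^i)` either way.
No computability is needed here. [folklore] -/
theorem real_ne {i : ℕ} {β : ℝ} (hβ : |β - ((G i (queryPt i) : ℚ) : ℝ)| < 1 / (8 * 4 ^ i)) :
    real G ≠ β := by
  set ρ : ℝ := ((G i (queryPt i) : ℚ) : ℝ) with hρ
  set m : ℕ := num G i with hm
  have h4 : (0 : ℝ) < 4 ^ i := by positivity
  have h8 : (0 : ℝ) < 8 * 4 ^ i := by positivity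
  have hlo := lower_le_real G (i + 1)
  have hhi := real_le_upper G (i + 1)
  rw [upper_eq, lower_succ] at hhi
  rw [lower_succ] at hlo
  have hlow : lower G i = (m : ℝ) / 4 ^ i := rfl
  rw [abs_lt] at hβ
  have hT := goLeft_eq_true_iff G i m
  cases hgl : goLeft G i (num G i) with
  | true =>
    have hmid : (2 * (m : ℝ) + 1) / (2 * 4 ^ i) ≤ ρ := hT.1 (hm ▸ hgl)
    rw [digit_of_goLeft G hgl] at hhi
    simp only [Nat.cast_zero, zero_div, add_zero] at hhi
    intro hx
    rw [hx, hlow, pow_succ] at hhi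
    -- `β ≤ m/4^i + 1/(4·4^i)` but `β > ρ - 1/(8·4^i) ≥ m/4^i + 3/(8·4^i)`
    have key : (2 * (m : ℝ) + 1) / (2 * 4 ^ i) - 1 / (8 * 4 ^ i) ≤
        (m : ℝ) / 4 ^ i + 1 / (4 ^ i * 4) := by
      linarith
    rw [div_add_div _ _ h4.ne' (by positivity : (4 : ℝ) ^ i * 4 ≠ 0),
      div_sub_div _ _ (by positivity : (2 : ℝ) * 4 ^ i ≠ 0) h8.ne',
      div_le_div_iff₀ (by positivity) (by positivity)] at key
    nlinarith [h4, mul_pos h4 h4, mul_pos (mul_pos h4 h4) h4]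
  | false =>
    have hmid : ρ < (2 * (m : ℝ) + 1) / (2 * 4 ^ i) := by
      by_contra hcon
      exact Bool.false_ne_true ((hm ▸ hgl).symm.trans (hT.2 (not_lt.1 hcon)))
    rw [digit_of_not_goLeft G hgl] at hlo
    simp only [Nat.cast_ofNat] at hlo
    intro hx
    rw [hx, hlow, pow_succ] at hlo
    -- `β ≥ m/4^i + 3/(4·4^i)` but `β < ρ + 1/(8·4^i) < m/4^i + 5/(8·4^i)`
    have key : (m : ℝ) / 4 ^ i + 3 / (4 ^ i * 4) <
        (2 * (m : ℝ) + 1) / (2 * 4 ^ i) + 1 / (8 * 4 ^ i) := by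
      linarith
    rw [div_add_div _ _ h4.ne' (by positivity : (4 : ℝ) ^ i * 4 ≠ 0),
      div_add_div _ _ (by positivity : (2 : ℝ) * 4 ^ i ≠ 0) h8.ne',
      div_lt_div_iff₀ (by positivity) (by positivity)] at key
    nlinarith [h4, mul_pos h4 h4, mul_pos (mul_pos h4 h4) h4]

/-- **Quantitative form**: `1/(8 · 4^i) ≤ |x - G i N_i|` for every row `i`. [folklore] -/
theorem le_abs_real_sub (i : ℕ) :
    1 / (8 * 4 ^ i) ≤ |real G - ((G i (queryPt i) : ℚ) : ℝ)| := by
  by_contra h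
  exact real_ne G (not_le.1 h) rfl

/-- `1/(N_i + 1) < 1/(8 · 4^i)`. [folklore] -/
theorem one_div_queryPt_succ_lt (i : ℕ) : 1 / ((queryPt i : ℝ) + 1) < 1 / (8 * 4 ^ i) := by
  rw [one_div_lt_one_div (by positivity) (by positivity)]
  simp [queryPt]

/-- No row of `G` is a `1/(n+1)`-name of the diagonal real: row `i` fails at `n = N_i`.
[folklore] -/
theorem not_name (i : ℕ) :
    ¬ ∀ n : ℕ, |real G - ((G i n : ℚ) : ℝ)| ≤ 1 / ((n : ℝ) + 1) := fun h =>
  real_ne G (lt_of_le_of_lt (h (queryPt i)) (one_div_queryPt_succ_lt i)) rfl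

/-- No row of `G` is a fast (`2⁻ⁿ`) Cauchy name of the diagonal real. [folklore] -/
theorem not_fastName (i : ℕ) :
    ¬ ∀ n : ℕ, |real G - ((G i n : ℚ) : ℝ)| ≤ (1 / 2 : ℝ) ^ n := fun h =>
  not_name G i fun n => (h n).trans (one_half_pow_le_one_div_succ n)

end UniformDiagonal

/-! ### Packaged statements -/

/-- **Effective diagonal, quantitative form.** For every computable double sequence of rationals
`G` there is a computable real `x` with `1/(8 · 4^i) ≤ |x - G i (8 · 4^i)|` for every `i`.
[folklore] -/
theorem exists_isComputableReal_forall_le_abs_sub (G : ℕ → ℕ → ℚ) (hG : Computable₂ G) :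
    ∃ x : ℝ, IsComputableReal x ∧ ∀ i : ℕ, 1 / (8 * 4 ^ i : ℝ) ≤ |x - G i (8 * 4 ^ i)| :=
  ⟨UniformDiagonal.real G, UniformDiagonal.isComputableReal_real hG,
    UniformDiagonal.le_abs_real_sub G⟩

/-- **Effective diagonal.** For every computable double sequence of rationals `G` there is a
computable real `x` of which no row `G i` is a `1/(n+1)`-name: the computable reals named by the
rows of one computable double sequence never exhaust the computable reals. [folklore] -/
theorem exists_isComputableReal_forall_not_name (G : ℕ → ℕ → ℚ) (hG : Computable₂ G) :
    ∃ x : ℝ, IsComputableReal x ∧ ∀ i : ℕ, ¬ ∀ n : ℕ, |x - G i n| ≤ 1 / ((n : ℝ) + 1) :=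
  ⟨UniformDiagonal.real G, UniformDiagonal.isComputableReal_real hG,
    UniformDiagonal.not_name G⟩

/-- **Effective diagonal, fast names.** For every computable double sequence of rationals `G`
there is a computable real `x` of which no row `G i` is a fast (`2⁻ⁿ`) Cauchy name. [folklore] -/
theorem exists_isComputableReal_forall_not_fastName (G : ℕ → ℕ → ℚ) (hG : Computable₂ G) :
    ∃ x : ℝ, IsComputableReal x ∧ ∀ i : ℕ, ¬ ∀ n : ℕ, |x - G i n| ≤ (1 / 2 : ℝ) ^ n :=
  ⟨UniformDiagonal.real G, UniformDiagonal.isComputableReal_real hG,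
    UniformDiagonal.not_fastName G⟩

/-! ### Corollary: a computable real which is not a primitive recursive real -/

/-- Three primitive recursive functions merged into one row of `primrecEnum` along the first
component of `Nat.unpair`. [folklore] -/
theorem exists_primrecEnum_eq_triple {a b c : ℕ → ℕ} (ha : Nat.Primrec a) (hb : Nat.Primrec b)
    (hc : Nat.Primrec c) : ∃ e : ℕ, ∀ n : ℕ, primrecEnum e (Nat.pair 0 n) = a n ∧
      primrecEnum e (Nat.pair 1 n) = b n ∧ primrecEnum e (Nat.pair 2 n) = c n := by
  have hg : Primrec₂ fun i n : ℕ => if i = 0 then a n else if i = 1 then b n else c n :=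
    Primrec.ite (Primrec.eq.comp Primrec.fst (Primrec.const 0))
      ((Primrec.nat_iff.2 ha).comp Primrec.snd)
      (Primrec.ite (Primrec.eq.comp Primrec.fst (Primrec.const 1))
        ((Primrec.nat_iff.2 hb).comp Primrec.snd) ((Primrec.nat_iff.2 hc).comp Primrec.snd))
  obtain ⟨e, he⟩ := exists_primrecEnum_eq (Primrec₂.unpaired'.2 hg)
  refine ⟨e, fun n => ?_⟩
  simp [he, Nat.unpaired, Nat.unpair_pair]

/-- The rows `n ↦ (u ⟨0,n⟩ - u ⟨1,n⟩)/(u ⟨2,n⟩ + 1)`, `u = primrecEnum e`: a computable double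
sequence of rationals whose rows include `(a n - b n)/(c n + 1)` for all primitive recursive
`a b c` (`exists_primrecEnum_eq_triple`). [folklore] -/
def primrecTripleSeq (e n : ℕ) : ℚ :=
  mkRat ((primrecEnum e (Nat.pair 0 n) : ℤ) - primrecEnum e (Nat.pair 1 n))
    (primrecEnum e (Nat.pair 2 n) + 1)

/-- `primrecTripleSeq` is computable (`primrecEnum_computable`, `primrec_mkRat_natSub`).
[folklore] -/
theorem computable_primrecTripleSeq : Computable₂ primrecTripleSeq := by
  have hu : ∀ k : ℕ, Computable fun p : ℕ × ℕ => primrecEnum p.1 (Nat.pair k p.2) := fun k =>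
    primrecEnum_computable.comp Computable.fst
      ((Primrec₂.natPair.comp (Primrec.const k) Primrec.snd).to_comp)
  exact (primrec_mkRat_natSub.to_comp.comp ((hu 0).pair ((hu 1).pair (hu 2)))).of_eq
    fun p => rfl

/-- The value of a row of `primrecTripleSeq` as a real number. [folklore] -/
theorem primrecTripleSeq_cast (e n : ℕ) : ((primrecTripleSeq e n : ℚ) : ℝ) =
    ((primrecEnum e (Nat.pair 0 n) : ℝ) - primrecEnum e (Nat.pair 1 n)) /
      ((primrecEnum e (Nat.pair 2 n) : ℝ) + 1) := by
  rw [primrecTripleSeq, Rat.mkRat_eq_div]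
  push_cast
  ring

/-- **A computable real which is not a primitive recursive real**: no primitive recursive
`a b c : ℕ → ℕ` satisfy `|x - (a n - b n)/(c n + 1)| ≤ 1/(n+1)` for all `n` (the class `ℝ_ℰ`,
`ℰ` = primitive recursive functions, of Yoshinaga 2008, Def. 2 / Example 3 (3), in the tree's
three-sequence form of `IsElementaryReal`). The effective diagonal applied to `primrecTripleSeq`;
it sharpens `exists_isComputableReal_not_isElementaryReal` (`NonElementaryReal.lean`), since
elementary functions are primitive recursive (`ElementaryRec.primrec_holds`). [folklore] -/
theorem exists_isComputableReal_not_primrecReal :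
    ∃ x : ℝ, IsComputableReal x ∧ ∀ a b c : ℕ → ℕ, Nat.Primrec a → Nat.Primrec b →
      Nat.Primrec c → ¬ ∀ n : ℕ, |x - ((a n : ℝ) - b n) / ((c n : ℝ) + 1)| ≤ 1 / ((n : ℝ) + 1) := by
  obtain ⟨x, hx, hne⟩ :=
    exists_isComputableReal_forall_not_name primrecTripleSeq computable_primrecTripleSeq
  refine ⟨x, hx, fun a b c ha hb hc happrox => ?_⟩
  obtain ⟨e, he⟩ := exists_primrecEnum_eq_triple ha hb hc
  refine hne e fun n => ?_
  rw [primrecTripleSeq_cast, (he n).1, (he n).2.1, (he n).2.2]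
  exact happrox n

end Literature.Computability.Complexity
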